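import Mathlib

/-!
# Lemma L, part 1: CM types as sign vectors, the zero-sum lattice, pairs, faces, squares

Blind re-derivation cell `pub-hodge-repro`, seat `typer-2`.  Mathlib only.

**Model.**  A CM field with `m` infinite places, one embedding fixed per place.  A CM type is its sign
vector `T : Fin m → Bool` (`true` at `i` = the fixed embedding at `i` belongs to `T`); `conj T = !T` is
the conjugate type and `flip p T` flips `T` at the place `p`.  A formal `ℤ`-combination of CM types is
`x : (Fin m → Bool) → ℤ`; it is ZERO-SUM when `∑ T, x T • v_T = 0` in `ℤ^m`, i.e. for every place `i`,
`∑ T, x T * sgn (T i) = 0` (every embedding is weighted like its conjugate) — the lattice `Z` of rank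
`2^m - m` of the lead's `LEMMA-L-P.md` (route/lattice-lead-g18/).

**Generators.**  The PAIRS `pairVec T = e_T + e_{conj T}` and the FACES `faceVec Φ p p'`, `p ≠ p'`, with
corners `Φ, flip p (conj Φ), flip p' (conj Φ), flip p' (flip p Φ)` — the rank-four faces `(Φ; π, π′)` of the
cell's sealed census (`Statements.lean` §A.3, `Sextic.Coordinates.corners`): the zero-sum quadruples
obtained from one type by flipping it at two places.

**Main theorem** (in `FaceLattice.lean`, which imports this file) `span_pairs_faces_eq_zeroSum`: for `m ≥ 1`,
`Submodule.span ℤ (pairs m ∪ faces m) = zeroSum m`.  This SHARPENS the lead's Lemma L (whose generators are all zero-sum 4-multisets without a conjugate pair):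
the census faces alone, with the pairs, generate `Z` for every `m ≥ 1`.

This file: the model, the lattice `zeroSum`, the generators (`pairs`, `faces`) and the easy inclusion `span_le`;
the squares `sq`, the edges, the two transport maps `Ψ l` (vertical squares) and `pairMap`, and `sq_eq`: a square is a
face modulo two pairs.
-/

namespace HodgeRepro.FaceLattice

open Finset

variable {m : ℕ}

/-! ### Types, conjugation, flips -/

/-- Sign of a Boolean: `+1` for `true`, `-1` for `false`. -/
def sgn (b : Bool) : ℤ := if b then 1 else -1

/-- `sgn` of the negation. -/
@[simp] theorem sgn_not (b : Bool) : sgn (!b) = -sgn b := by cases b <;> simp [sgn]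

/-- `sgn` never vanishes. -/
theorem sgn_ne_zero (b : Bool) : sgn b ≠ 0 := by cases b <;> simp [sgn]

/-- CM types of a CM field with `m` infinite places, as sign vectors. -/
abbrev CMType (m : ℕ) := Fin m → Bool

/-- The conjugate type `T̄`. -/
def conj (T : CMType m) : CMType m := fun i => !T i

/-- Value of the conjugate at a place. -/
@[simp] theorem conj_apply (T : CMType m) (i : Fin m) : conj T i = !T i := rfl

/-- Conjugation is an involution. -/
@[simp] theorem conj_conj (T : CMType m) : conj (conj T) = T := by funext i; simp

/-- Flip at the place `p`: `T ∆ {p}`. -/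
def flip (p : Fin m) (T : CMType m) : CMType m := Function.update T p (!T p)

/-- Value of the flip at the flipped place. -/
@[simp] theorem flip_apply_self (p : Fin m) (T : CMType m) : flip p T p = !T p := by simp [flip]

/-- Value of the flip at another place. -/
theorem flip_apply_of_ne {p i : Fin m} (h : i ≠ p) (T : CMType m) : flip p T i = T i := by
  simp [flip, Function.update_of_ne h]

/-- Flipping twice at the same place is the identity. -/
@[simp] theorem flip_flip (p : Fin m) (T : CMType m) : flip p (flip p T) = T := by
  funext i
  by_cases h : i = p
  · subst h; simp
  · simp [flip_apply_of_ne h]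

/-- Flips at different places commute. -/
theorem flip_comm {p q : Fin m} (h : p ≠ q) (T : CMType m) : flip p (flip q T) = flip q (flip p T) := by
  funext i
  by_cases hp : i = p
  · subst hp; simp [flip_apply_of_ne h]
  · by_cases hq : i = q
    · subst hq; simp [flip_apply_of_ne (Ne.symm h)]
    · simp [flip_apply_of_ne hp, flip_apply_of_ne hq]

/-- Flipping commutes with conjugation. -/
theorem flip_conj (p : Fin m) (T : CMType m) : flip p (conj T) = conj (flip p T) := by
  funext i
  by_cases h : i = p
  · subst h; simp
  · simp [flip_apply_of_ne h]

/-- The flip at `p` as a permutation of the types. -/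
def flipPerm (p : Fin m) : Equiv.Perm (CMType m) := Function.Involutive.toPerm (flip p) (flip_flip p)

/-! ### The lattice, the pairs, the faces -/

/-- The basis vector `e_T` of a type. -/
def e (T : CMType m) : CMType m → ℤ := Pi.single T 1

/-- `e_T` evaluated. -/
theorem e_apply (T S : CMType m) : e T S = if S = T then 1 else 0 := by simp [e, Pi.single_apply]

/-- The pair `T + T̄`. -/
def pairVec (T : CMType m) : CMType m → ℤ := e T + e (conj T)

/-- The face `(Φ; p, p′)`, corners `Φ, flip p Φ̄, flip p′ Φ̄, flip p′ (flip p Φ)`. -/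
def faceVec (Φ : CMType m) (p p' : Fin m) : CMType m → ℤ :=
  e Φ + e (flip p (conj Φ)) + e (flip p' (conj Φ)) + e (flip p' (flip p Φ))

/-- The set of pairs. -/
def pairs (m : ℕ) : Set (CMType m → ℤ) := Set.range pairVec

/-- The set of faces `(Φ; p, p′)` with `p ≠ p′`. -/
def faces (m : ℕ) : Set (CMType m → ℤ) := {y | ∃ Φ p p', p ≠ p' ∧ y = faceVec Φ p p'}

/-- The weight of a combination at the place `i`: `∑ T, x T * sgn (T i)`. -/
def weight (i : Fin m) : (CMType m → ℤ) →ₗ[ℤ] ℤ where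
  toFun x := ∑ T, x T * sgn (T i)
  map_add' x y := by simp [add_mul, Finset.sum_add_distrib]
  map_smul' c x := by simp [Finset.mul_sum, mul_assoc]

/-- `weight` evaluated. -/
theorem weight_apply (i : Fin m) (x : CMType m → ℤ) : weight i x = ∑ T, x T * sgn (T i) := rfl

/-- The zero-sum lattice `Z`: weight `0` at every place. -/
def zeroSum (m : ℕ) : Submodule ℤ (CMType m → ℤ) := ⨅ i, LinearMap.ker (weight i)

/-- Membership in `Z`. -/
theorem mem_zeroSum {x : CMType m → ℤ} : x ∈ zeroSum m ↔ ∀ i, weight i x = 0 := by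
  simp [zeroSum, Submodule.mem_iInf, LinearMap.mem_ker]

/-- The weight of a basis vector. -/
theorem weight_e (i : Fin m) (T : CMType m) : weight i (e T) = sgn (T i) := by
  rw [weight_apply, Finset.sum_eq_single T]
  · simp [e_apply]
  · intro S _ hS; simp [e_apply, hS]
  · simp

/-- Pairs are zero-sum. -/
theorem pairVec_mem (T : CMType m) : pairVec T ∈ zeroSum m := by
  rw [mem_zeroSum]; intro i; simp [pairVec, weight_e]

/-- Faces are zero-sum (each place lies in exactly two corners). -/
theorem faceVec_mem {p p' : Fin m} (h : p ≠ p') (Φ : CMType m) : faceVec Φ p p' ∈ zeroSum m := by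
  rw [mem_zeroSum]; intro i
  simp only [faceVec, map_add, weight_e]
  by_cases hp : i = p
  · subst hp; simp [flip_apply_of_ne h]
  · by_cases hp' : i = p'
    · subst hp'; simp [flip_apply_of_ne (Ne.symm h)]
    · simp [flip_apply_of_ne hp, flip_apply_of_ne hp']

/-- The easy inclusion: pairs and faces are zero-sum. -/
theorem span_le : Submodule.span ℤ (pairs m ∪ faces m) ≤ zeroSum m := by
  refine Submodule.span_le.mpr (Set.union_subset ?_ ?_)
  · rintro _ ⟨T, rfl⟩; exact pairVec_mem T
  · rintro _ ⟨Φ, p, p', h, rfl⟩; exact faceVec_mem h Φ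

/-! ### Squares, edges, and the two transport maps -/

/-- The square `e_T - e_{flip k T} - e_{flip l T} + e_{flip l (flip k T)}` (a face modulo two pairs). -/
def sq (T : CMType m) (l k : Fin m) : CMType m → ℤ :=
  e T - e (flip k T) - e (flip l T) + e (flip l (flip k T))

/-- The set of squares `sq T l k`, `l ≠ k`. -/
def squares (m : ℕ) : Set (CMType m → ℤ) := {y | ∃ T l k, l ≠ k ∧ y = sq T l k}

/-- The edges `e_T - e_{flip k T}` in the free directions `k ∉ S`. -/
def edges (S : Finset (Fin m)) : Set (CMType m → ℤ) := {y | ∃ T, ∃ k ∉ S, y = e T - e (flip k T)}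

/-- The vertical-square map `Ψ l : x ↦ x - x ∘ flip l`. -/
def Ψ (l : Fin m) : (CMType m → ℤ) →ₗ[ℤ] (CMType m → ℤ) := LinearMap.id - LinearMap.funLeft ℤ ℤ (flip l)

/-- `Ψ` evaluated. -/
theorem Ψ_apply (l : Fin m) (x : CMType m → ℤ) (T : CMType m) : Ψ l x T = x T - x (flip l T) := by
  simp [Ψ, LinearMap.funLeft_apply]

/-- The pair map `pairMap : x ↦ x + x ∘ conj`. -/
def pairMap : (CMType m → ℤ) →ₗ[ℤ] (CMType m → ℤ) := LinearMap.id + LinearMap.funLeft ℤ ℤ conj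

/-- `pairMap` evaluated. -/
theorem pairMap_apply (x : CMType m → ℤ) (T : CMType m) : pairMap x T = x T + x (conj T) := by
  simp [pairMap, LinearMap.funLeft_apply]

/-- `Ψ l` on a basis vector: the edge `e_T - e_{flip l T}`. -/
theorem Ψ_e (l : Fin m) (T : CMType m) : Ψ l (e T) = e T - e (flip l T) := by
  funext S
  have : flip l S = T ↔ S = flip l T := ⟨fun h => by rw [← h, flip_flip], fun h => by rw [h, flip_flip]⟩
  simp [Ψ_apply, e_apply, this]

/-- `pairMap` on a basis vector: the pair `pairVec T`. -/
theorem pairMap_e (T : CMType m) : pairMap (e T) = pairVec T := by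
  funext S
  have : conj S = T ↔ S = conj T := ⟨fun h => by rw [← h, conj_conj], fun h => by rw [h, conj_conj]⟩
  simp [pairMap_apply, pairVec, e_apply, this]

/-- A linear map sending every basis vector into `span G` sends everything into `span G`. -/
theorem map_mem_span {G : Set (CMType m → ℤ)} (Φ : (CMType m → ℤ) →ₗ[ℤ] (CMType m → ℤ))
    (h : ∀ T, Φ (e T) ∈ Submodule.span ℤ G) (x : CMType m → ℤ) : Φ x ∈ Submodule.span ℤ G := by
  rw [pi_eq_sum_univ' x, map_sum]
  exact Submodule.sum_mem _ fun T _ => by rw [map_smul]; exact Submodule.smul_mem _ _ (h T)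

/-- `Ψ l` sends an edge in the direction `k` to the square `sq T l k`. -/
theorem Ψ_edge (l k : Fin m) (T : CMType m) : Ψ l (e T - e (flip k T)) = sq T l k := by
  rw [map_sub, Ψ_e, Ψ_e, sq]; abel

/-- A square is a face modulo two pairs: `sq T l k = faceVec T l k - pairVec (flip l T) - pairVec (flip k T)`. -/
theorem sq_eq (T : CMType m) {l k : Fin m} (h : l ≠ k) :
    sq T l k = faceVec T l k - pairVec (flip l T) - pairVec (flip k T) := by
  rw [sq, faceVec, pairVec, pairVec, flip_conj, flip_conj, flip_comm h]; abel

/-- Squares lie in the span of pairs and faces. -/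
theorem sq_mem_span (T : CMType m) {l k : Fin m} (h : l ≠ k) :
    sq T l k ∈ Submodule.span ℤ (pairs m ∪ faces m) := by
  rw [sq_eq T h]
  refine Submodule.sub_mem _ (Submodule.sub_mem _ ?_ ?_) ?_
  · exact Submodule.subset_span (Or.inr ⟨T, l, k, h, rfl⟩)
  · exact Submodule.subset_span (Or.inl ⟨flip l T, rfl⟩)
  · exact Submodule.subset_span (Or.inl ⟨flip k T, rfl⟩)

/-- The span of the squares lies in the span of pairs and faces. -/
theorem squares_span_le : Submodule.span ℤ (squares m) ≤ Submodule.span ℤ (pairs m ∪ faces m) := by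
  refine Submodule.span_le.mpr ?_
  rintro _ ⟨T, l, k, h, rfl⟩
  exact sq_mem_span T h

end HodgeRepro.FaceLattice
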